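import Literature.AnabelianGeometry.AbsoluteAnabelian.ArchimedeanLogFrobeniusModel
import Literature.AnabelianGeometry.AbsoluteAnabelian.AbsTopIII.AutHolLogFrobeniusAssembly
import Literature.AnabelianGeometry.AbsoluteAnabelian.RigidFunctors
import Literature.AnabelianGeometry.AbsoluteAnabelian.SlimIdRigid
import Mathlib.CategoryTheory.Discrete.Basic
import HarnessLib

/-!
# [AbsTopIII] Cor 4.5 AT THE ARCHIMEDEAN MODEL: the four model inputs discharged or named

Mochizuki, *Topics in Absolute Anabelian Geometry III*, §4, Cor 4.5 (i)–(v) pp. 107–110, Prop 4.2 (i)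
p. 105, Lemma 4.4 p. 107 of the author's kurims manuscript (lit key `paper:url-5493eb38cbb7`; bib key
`MochizukiAbsTopIII2015`).  PROOF-ONLY companion (abc-iut cell, sub-DAG `AbsTopIII:Cor4.5`, row C45-M0 of
plan/L4/SUBDAG-AbsTopIII-Cor45.md; seat abc-iut-L4-t10).  No new notion is declared.

The MODEL `Δ_𝔄 := archLogFrobeniusData 𝔄` (`ArchimedeanLogFrobeniusModel.lean`: `𝒳 = 𝒞^hol_TF`,
`𝒩 = 𝒞^hol_TH`, `ℰ = EA`, `𝒜 = LinHol`, `log`, `λ^×`, `λ^∼`, `ι_log`, `ι_×`, `κ_LH`, `φ_LH`, `η_LH` as real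
categories and functors over the Cor 2.7 (e)+functoriality interface `𝔄 : AutHolFieldFunctor`) is fed
into abc-iut-w5-d210's assembly `cor_4_5_of_inputs` (Cor 4.5 (i)–(v) over abstract data REDUCED to the
printed model inputs).  Of those inputs, at the model:

* (M1) orientation `ι_× = inr ι` — `rfl` (`arch_isAutHolDirection`);
* (M3) the component-level content of **Lemma 4.4** (`Lemma44Property ι`) — PROVED
  (`arch_lemma44Property`): through the underlying-arithmetic-datum functor `𝒞^hol_TH ⥤ Type` the
  composite `λ^×(a) ≫ ι_log ≫ ι_×` IS `z ↦ exp_k (α z)` on `k^×`, `α = a_M` a field automorphism, which is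
  not injective because `exp_k` is not injective on `k ∖ {0}` (abc-iut-w5-d210's
  `IsCAF.exists_ne_univCover_eq`) — "the non-injectivity of `k~ ↠ k^×` implies that the composite …
  fails to be injective";
* the printed-case shape hypotheses of (ii) — `id_⋎ = 𝟭` fully faithful, `τ = ⟨φ_LH, unitor, η_LH⟩`
  coherent (`arch_telecore_coherent`) — hold by construction;
* (M4) id-rigidity of `𝒳 = 𝒞^hol_TF` — REDUCED to id-rigidity of `EA` (`HolTFPair.isIdRigid_of_isIdRigid_EA`:
  `𝕏 ↦ (𝕏 ↶ 𝒜_𝕏)` is an equivalence `EA ≌ 𝒞^hol_TF`; this is the deduction "in light of the bijectivity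
  portion of assertion (i), the id-rigidity of … `𝒞^hol_T` … follows" of the proof of Prop 4.2 (i)); the
  id-rigidity of `EA` itself ("Thus, the id-rigidity of `EA` follows immediately from the slimness
  assertion of Lemma 4.3", via Cor 2.3 (i) / `Loc_R(X)`) remains the ONE named input `hE`, together
  with (M2) an object `X₀` of `EA`.

Capstone: `cor_4_5_arch 𝔄 X₀ hE : Cor_4_5 (archLogFrobeniusData 𝔄) (archTelecoreData 𝔄)` — [AbsTopIII]
Cor 4.5 (i)–(v) AS TYPED (abc-iut-L4-t10's `Cor_4_5 = LogFrobeniusCompatible`) for the archimedean model,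
from an object of `EA` and the id-rigidity of `EA` ONLY.  Also: Prop 4.2 (i)'s displayed bijection
`Isom_𝒞((𝕏 ↶ M),(𝕏* ↶ M*)) ⥲ Isom_EA(𝕏, 𝕏*)` at the model (`HolTFPair.mapIso_toEA_bijective`).

Non-vacuity (kernel witness, built inside a proof so nothing enters the library): the interface
`AutHolFieldFunctor` is inhabited — one object, `𝒜 = ℂ`, `𝒜_{id} = id` — with `EA` nonempty and id-rigid,
so the two binders of `cor_4_5_arch` are simultaneously satisfiable (`cor_4_5_arch_hypotheses_satisfiable`);
a toy, it says nothing about the geometric instance of Cor 2.7.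

Refereed pre-IUT anabelian geometry; the existence of the interface `𝔄` on the geometric carriers
(Cor 2.7) is NOT asserted; nothing here bears on [IUTchIII] Cor. 3.12 or takes a side.
-/

namespace Literature.AnabelianGeometry.AbsoluteAnabelian

open _root_.CategoryTheory

universe u

namespace HolTFPair

variable (𝔄 : AutHolFieldFunctor.{u})

/-- **Prop 4.2 (i), id-rigidity clause, at the model**: if `EA` is id-rigid then so is `𝒳 = 𝒞^hol_TF`
("in light of the bijectivity portion of assertion (i), the id-rigidity of the categories … `𝒞^hol_T` …
follows in a similar fashion") — `𝕏 ↦ (𝕏 ↶ 𝒜_𝕏)` is an equivalence `EA ≌ 𝒞^hol_TF` and id-rigidity is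
invariant under equivalence. [cite: MochizukiAbsTopIII2015, Proposition 4.2 (i) p.105] -/
theorem isIdRigid_of_isIdRigid_EA (hE : IsIdRigid 𝔄.EA) : IsIdRigid (HolTFPair 𝔄) :=
  haveI := ofEA_isEquivalence 𝔄
  isIdRigid_of_equivalence' (ofEA 𝔄).asEquivalence hE

variable {𝔄} in
/-- **Prop 4.2 (i) at the model**: "the natural functor of Definition 4.1, (iii), induces a bijection
`Isom_{𝒞^hol_T}((𝕏 ↶ M),(𝕏* ↶ M*)) ⥲ Isom_EA(𝕏, 𝕏*)` on sets of isomorphisms" (`T = TF`).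
[cite: MochizukiAbsTopIII2015, Proposition 4.2 (i) p.105] -/
theorem mapIso_toEA_bijective (P Q : HolTFPair 𝔄) :
    Function.Bijective (fun φ : P ≅ Q => (toEA 𝔄).mapIso φ) := by
  constructor
  · intro φ ψ h
    have hh : φ.hom.base = ψ.hom.base := by
      have := congrArg Iso.hom h
      simpa using this
    exact Iso.ext (Hom.ext_of_base hh)
  · intro f
    refine ⟨⟨Hom.ofBase P Q f.hom, Hom.ofBase Q P f.inv, ?_, ?_⟩, ?_⟩
    · apply Hom.ext_of_base
      change f.hom ≫ f.inv = 𝟙 P.X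
      exact f.hom_inv_id
    · apply Hom.ext_of_base
      change f.inv ≫ f.hom = 𝟙 Q.X
      exact f.inv_hom_id
    · exact Iso.ext rfl

end HolTFPair

namespace AbsTopIII

variable (𝔄 : AutHolFieldFunctor.{u})

/-- (M1) **The archimedean model is of Aut-holomorphic type**: `ι_×` is the right summand `λ^∼ → λ^×`
(Rmk 4.5.2 "certain … arrows … go in the opposite direction"). [cite: MochizukiAbsTopIII2015, Remark 4.5.2 p.111] -/
theorem arch_isAutHolDirection : IsAutHolDirection (archLogFrobeniusData 𝔄) :=
  ⟨HolTFPair.iotaTimes 𝔄, rfl⟩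

/-- The composite `λ^×(a) ≫ ι_log ≫ ι_×` of the proof of Cor 4.5 (iv), read on the underlying arithmetic
datum `k^×`: it is `z ↦ exp_k (a_M z)` ("`k^× →α (k~)^× ↪ k~ ↠ k^×`").
[cite: MochizukiAbsTopIII2015, Corollary 4.5 (iv) p.110] -/
theorem arch_lemma44_composite_apply (x : (archLogFrobeniusData 𝔄).X₁)
    (a : (archLogFrobeniusData 𝔄).toNexus.obj x ⟶
      (archLogFrobeniusData 𝔄).toNexus.obj ((archLogFrobeniusData 𝔄).log.obj x))
    (z : ((archLogFrobeniusData 𝔄).lamTimes.obj ((archLogFrobeniusData 𝔄).toNexus.obj x)).carrier) :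
    (((archLogFrobeniusData 𝔄).lamTimes.map a ≫ ιlogApp x ≫
        (HolTFPair.iotaTimes 𝔄).app ((archLogFrobeniusData 𝔄).toNexus.obj x)).toFun z : HolTFPair.k x) =
      @univCover (HolTFPair.k x) _ (HolTFPair.charZero_k x) (HolTFPair.Hom.arith a z.1) :=
  rfl

/-- (M3) **Lemma 4.4 supplies the `Lemma44Property` of the archimedean model**: for every first-row
object `(𝕏 ↶ k)` and every isomorphism `a`, the composite `λ^×(a) ≫ ι_log ≫ ι_×` is not the identity —
through the underlying-datum functor it is `z ↦ exp_k (a_M z)` on `k^×`, which is not injective since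
`exp_k` identifies two distinct nonzero elements ("the non-injectivity of `k~ ↠ k^×` implies that the
composite under consideration fails to be injective", proof of Lemma 4.4).
[cite: MochizukiAbsTopIII2015, Lemma 4.4 p.107] -/
theorem arch_lemma44Property :
    Lemma44Property (Δ := archLogFrobeniusData 𝔄) (HolTFPair.iotaTimes 𝔄) := by
  refine lemma44Property_of_not_bijective (Δ := archLogFrobeniusData 𝔄) (HolTFPair.iotaTimes 𝔄)
    (HolTHPair.forget 𝔄) (fun x a ha hbij => ?_)
  haveI : CharZero (HolTFPair.k x) := HolTFPair.charZero_k x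
  -- two distinct nonzero elements with the same exponential
  obtain ⟨x₀, y₀, hx₀, hy₀, hne, hexp⟩ := IsCAF.exists_ne_univCover_eq (HolTFPair.isCAF x)
  -- the arithmetic part of the isomorphism `a` is surjective
  have hsurj : ∀ m : HolTFPair.k x, HolTFPair.Hom.arith a (HolTFPair.Hom.arith (inv a) m) = m := by
    intro m
    have h := congrArg (fun φ => HolTFPair.Hom.arith φ m) (IsIso.inv_hom_id a)
    exact h
  set z₁ : HolTFPair.k x := HolTFPair.Hom.arith (inv a) x₀ with hz₁
  set z₂ : HolTFPair.k x := HolTFPair.Hom.arith (inv a) y₀ with hz₂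
  have hz₁0 : z₁ ≠ 0 := (map_ne_zero_iff _ (HolTFPair.Hom.arith (inv a)).injective).mpr hx₀
  have hz₂0 : z₂ ≠ 0 := (map_ne_zero_iff _ (HolTFPair.Hom.arith (inv a)).injective).mpr hy₀
  have hz : z₁ ≠ z₂ := fun h => hne (by rw [← hsurj x₀, ← hsurj y₀, ← hz₁, ← hz₂, h])
  apply hz
  have hval := hbij.1 (a₁ := ⟨z₁, hz₁0⟩) (a₂ := ⟨z₂, hz₂0⟩) (Subtype.ext (by
    rw [HolTHPair.forget_map_apply_coe, HolTHPair.forget_map_apply_coe]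
    change @univCover (HolTFPair.k x) _ (HolTFPair.charZero_k x) (HolTFPair.Hom.arith a z₁) =
      @univCover (HolTFPair.k x) _ (HolTFPair.charZero_k x) (HolTFPair.Hom.arith a z₂)
    rw [hz₁, hz₂, hsurj, hsurj]
    exact hexp))
  exact congrArg Subtype.val hval

/-- The first-row telecore data `⟨φ_LH, unitor, η_LH⟩` of the model is COHERENT (the printed-case shape
hypothesis of abc-iut-L4-t5's `cor_4_5_ii_of_coherent`: `id_⋎(η_⋎) = η_{□⋎} ≫ η_LH`, all identities
here). [cite: MochizukiAbsTopIII2015, Corollary 4.5 (ii) p.108] -/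
theorem arch_telecore_coherent (x : (archLogFrobeniusData 𝔄).X₁) :
    (archLogFrobeniusData 𝔄).toNexus.map ((archTelecoreData 𝔄).η₁.hom.app x) =
      (archTelecoreData 𝔄).e.hom.app ((archLogFrobeniusData 𝔄).κ.obj
        ((archLogFrobeniusData 𝔄).XtoE.obj ((archLogFrobeniusData 𝔄).toNexus.obj x))) ≫
        (archLogFrobeniusData 𝔄).η.hom.app ((archLogFrobeniusData 𝔄).toNexus.obj x) := by
  change HolTFPair.ofOfEA x = 𝟙 _ ≫ HolTFPair.ofOfEA x
  rw [Category.id_comp]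

/-- **[AbsTopIII] Corollary 4.5 (i)–(v) for the archimedean MODEL** `archLogFrobeniusData 𝔄` with its
telecore data `⟨φ_LH, unitor, η_LH⟩`, from exactly two inputs: an object `𝕏₀` of `EA` (an elliptically
admissible Aut-holomorphic orbispace exists) and the id-rigidity of `EA` (Prop 4.2 (i), "from the
slimness assertion of Lemma 4.3").  The orientation (Rmk 4.5.2), Lemma 4.4, the coherence of the
telecore data and the id-rigidity of `𝒞^hol_TF` given that of `EA` are discharged above; items (i)–(v)
themselves are abc-iut-L4-t10 / -t5 / -w4-d095 / -w5-d210's theorems over abstract data.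
[cite: MochizukiAbsTopIII2015, Corollary 4.5 pp.107–109] -/
theorem cor_4_5_arch (X₀ : 𝔄.EA) (hE : IsIdRigid 𝔄.EA) :
    Literature.AnabelianGeometry.AbsoluteAnabelian.AbsTopIII.Cor_4_5 (archLogFrobeniusData 𝔄)
      (archTelecoreData 𝔄) :=
  cor_4_5_of_inputs (Δ := archLogFrobeniusData 𝔄) (archTelecoreData 𝔄)
    (Functor.FullyFaithful.id (HolTFPair 𝔄)) (arch_telecore_coherent 𝔄) (HolTFPair.iotaTimes 𝔄) rfl
    ((LinHol.κLH 𝔄).obj X₀) (arch_lemma44Property 𝔄)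
    (HolTFPair.isIdRigid_of_isIdRigid_EA 𝔄 hE) (HolTFPair.isIdRigid_of_isIdRigid_EA 𝔄 hE)
    (HolTFPair.isIdRigid_of_isIdRigid_EA 𝔄 hE)

/-- The five printed items separately, for the model. [cite: MochizukiAbsTopIII2015, Corollary 4.5 pp.107–109] -/
theorem cor_4_5_arch_items (X₀ : 𝔄.EA) (hE : IsIdRigid 𝔄.EA) :
    Cor_4_5_i (archLogFrobeniusData 𝔄) ∧ Cor_4_5_ii (archLogFrobeniusData 𝔄) (archTelecoreData 𝔄) ∧
      Cor_4_5_iii (archLogFrobeniusData 𝔄) ∧ Cor_4_5_iv (archLogFrobeniusData 𝔄) (archTelecoreData 𝔄) ∧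
      Cor_4_5_v (archLogFrobeniusData 𝔄) :=
  (cor_4_5_iff _ _).mp (cor_4_5_arch 𝔄 X₀ hE)

/-- **Cor 4.5 for the model from slimness**: the same with the id-rigidity of `EA` replaced by the
slimness of the category `EA` (abc-iut-w5-d215's `isIdRigid_of_isSlim`: a slim category is id-rigid —
the route "the id-rigidity of `EA` follows immediately from the slimness assertion of Lemma 4.3" of the
proof of Prop 4.2 (i), read at the level of the category `Loc_R(X)`).
[cite: MochizukiAbsTopIII2015, Proposition 4.2 (i) p.106] -/
theorem cor_4_5_arch_of_isSlim (X₀ : 𝔄.EA)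
    (hE : Literature.AlgebraicGeometry.Frobenioids.IsSlim 𝔄.EA) :
    Literature.AnabelianGeometry.AbsoluteAnabelian.AbsTopIII.Cor_4_5 (archLogFrobeniusData 𝔄)
      (archTelecoreData 𝔄) :=
  cor_4_5_arch 𝔄 X₀ (isIdRigid_of_isSlim hE)

/-! ### Non-vacuity of the binders -/

/-- **The binders of `cor_4_5_arch` are simultaneously satisfiable**: there is an interface datum `𝔄`
(the one-object category, `𝒜 = ℂ`, induced isomorphisms the identity) whose `EA` has an object and is
id-rigid; hence `Cor_4_5` of the corresponding archimedean model holds outright.  A consistency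
witness for the abstract layer only (the geometric `EA` of Cor 2.7 is not constructed).
[cite: MochizukiAbsTopIII2015, Corollary 4.5 pp.107–109] -/
theorem cor_4_5_arch_hypotheses_satisfiable :
    ∃ 𝔄 : AutHolFieldFunctor.{0}, Nonempty 𝔄.EA ∧ IsIdRigid 𝔄.EA ∧
      Literature.AnabelianGeometry.AbsoluteAnabelian.AbsTopIII.Cor_4_5 (archLogFrobeniusData 𝔄)
        (archTelecoreData 𝔄) := by
  let 𝔄 : AutHolFieldFunctor.{0} :=
    { EA := Discrete PUnit.{2}, A := fun _ => ℂ, isCAF := fun _ => isCAF_complex,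
      Amap := fun _ => RingEquiv.refl ℂ, continuous_Amap := fun _ => continuous_id,
      continuous_Amap_symm := fun _ => continuous_id, Amap_id := fun _ => rfl,
      Amap_comp := fun _ _ => rfl }
  have hE : IsIdRigid 𝔄.EA :=
    fun α => Iso.ext (NatTrans.ext (funext fun _ => Subsingleton.elim _ _))
  exact ⟨𝔄, ⟨⟨PUnit.unit⟩⟩, hE, cor_4_5_arch 𝔄 ⟨PUnit.unit⟩ hE⟩

end AbsTopIII

end Literature.AnabelianGeometry.AbsoluteAnabelian
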